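/-
Copyright (c) 2026. All rights reserved.
Released under Apache 2.0 license as described in the file LICENSE.
-/
import Mathlib
import HarnessLib
import Literature.MathematicalPhysics.QuantumLattice.AbelianFieldTensor
import Literature.MathematicalPhysics.QuantumLattice.AbelianMagneticFlux
import Summits.Ventures.LatticeQCDFlow.Scaling.FluxSectorCollar
import Summits.Ventures.LatticeQCDFlow.Scaling.BoxSpreadWitness
import Summits.Ventures.LatticeQCDFlow.Scaling.FluxInsertionBox
import Summits.Ventures.LatticeQCDFlow.Scaling.FluxInsertionHeightLaw
import Summits.Ventures.LatticeQCDFlow.Scaling.TorusPotential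
import Summits.Ventures.LatticeQCDFlow.Scaling.FluxInsertionHeightCeiling
import Summits.Ventures.LatticeQCDFlow.Scaling.SectorActionFloor
import Summits.Ventures.LatticeQCDFlow.Scaling.FluxInsertionMountainPass

/-!
# The two passes of the block flux-insertion kernel: the mountain pass (up to half the torus) and
the evenly spread instanton (beyond) — lean-1 GEN-6, own work (conjecture C9″b of THEORY-2.md)

HONEST FRAMING: exact (Metropolis-corrected) sampling algorithms for lattice gauge theory;
figures of merit are autocorrelation/cost numbers at stated couplings and volumes; no
continuum-physics claim.

Venture `LatticeQCDFlow` (cell pub-lqcd), topic `Scaling`, FANOUT row 30 (lean-1).  NEW WORK of the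
cell; nothing here is cited as a fact.  Setting of items 106b/107b (theory2): `d = 2`, compact
`U(1)`, torus `(ℤ/L)²`, the block spread `W = boxSpread l` (`2 ≤ l`, `l + 1 ≤ L`), `N = (l+1)² − 4`
touching positions (`inR`), `M = L² − N`, `α_l = 2π/N`, `E* = N(1 − cos(π/N)) + M(1 − cos(π/M))`,
`S₁ = L²(1 − cos(2π/L²))`, `boxHeight l L` = the essential min–max height of item 106b.

* `card_filter_inR` (`#R = N`), `card_filter_not_inR` (`#Rᶜ = M`), `plaquetteHolonomy_boxSpread_ite`.
* `sharpValue_le_max_wilsonAction` (`2N ≤ L²`): for EVERY `U` with `Q(WU) ≠ Q(U)`,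
  `max(S(U), S(WU)) ≥ E*` — the generic mountain pass (`FluxInsertionMountainPass`) instantiated.
* `sectorFloor_le_max_wilsonAction` (every regime, `3 ≤ L`): `max(S(U), S(XU)) ≥ S₁` whenever
  `Q(XU) ≠ Q(U)` (one of the two charges is nonzero; `SectorActionFloor`).
* `boxHeight_le_sectorFloor_ennreal` (`L² ≤ 2N`): `boxHeight l L ≤ S₁`, witnessed through item
  107b's `insHeight_le_of_witness` by `U₀ = potField(2π/L² − boxF)` (item 107a), for which
  `Q(U₀) = 0`, `Q(WU₀) = 1`, `WU₀` = the uniform charge-one field and `S(U₀) ≤ S(WU₀) = S₁`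
  (`sum_instTable`, `instTable_bounds`, `cos_le_cos_instTable`).
The values of the height are drawn in `FluxInsertionHeightValue`.  No `def`.
-/

noncomputable section

open MeasureTheory Filter Topology Real Set
open scoped ENNReal
open Literature.MathematicalPhysics.QuantumFieldTheory Literature.MathematicalPhysics.QuantumLattice
open Summit.Ventures.LatticeQCDFlow.Exactness

namespace Summit.Ventures.LatticeQCDFlow.Theory2.Lattice.Flux

/-! ## §1 The block spread as a generic insertion; the mountain pass -/

section Block

variable {L : ℕ} [NeZero L] {l : ℕ}

/-- The number of touching positions is `N = (l−1)(l+3)` (read off `Σ_x boxF = 2π`). [folklore] -/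
theorem card_filter_inR (hl : 2 ≤ l) (hlL : l + 1 ≤ L) :
    (((Finset.univ.filter fun x : Site 2 L => inR l (x 0).val (x 1).val).card : ℕ) : ℝ) =
      (((l + 1) * (l + 1) - 4 : ℕ) : ℝ) := by
  classical
  set R := Finset.univ.filter fun x : Site 2 L => inR l (x 0).val (x 1).val with hR
  have h1 : ∑ x ∈ R, boxF l (x 0).val (x 1).val = R.card * boxAlpha l := by
    rw [Finset.sum_congr rfl fun x hx => boxF_of_inR (l := l) (Finset.mem_filter.mp hx).2,
      Finset.sum_const, nsmul_eq_mul]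
  have h2 : ∑ x ∈ Finset.univ.filter (fun x : Site 2 L => ¬inR l (x 0).val (x 1).val),
      boxF l (x 0).val (x 1).val = 0 :=
    Finset.sum_eq_zero fun x hx => boxF_of_not_inR (l := l) (Finset.mem_filter.mp hx).2
  have h := sum_boxF_site (L := L) hl hlL
  rw [← Finset.sum_filter_add_sum_filter_not Finset.univ
      (fun x : Site 2 L => inR l (x 0).val (x 1).val), h1, h2, add_zero] at h
  obtain ⟨h1', h3'⟩ := boxDen_ne_zero hl
  have hD : ((l : ℝ) - 1) * ((l : ℝ) + 3) ≠ 0 := mul_ne_zero h1' h3'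
  have hα : boxAlpha l = 2 * π / (((l : ℝ) - 1) * ((l : ℝ) + 3)) := rfl
  rw [natCast_boxN hl]
  rw [hα] at h
  have h2π : (2 : ℝ) * π ≠ 0 := by positivity
  calc (R.card : ℝ) = R.card * (2 * π / (((l : ℝ) - 1) * ((l : ℝ) + 3))) *
        (((l : ℝ) - 1) * ((l : ℝ) + 3) / (2 * π)) := by field_simp
    _ = ((l : ℝ) - 1) * ((l : ℝ) + 3) := by rw [h]; field_simp

/-- The number of non-touching positions is `M = L² − N`. [folklore] -/
theorem card_filter_not_inR (hl : 2 ≤ l) (hlL : l + 1 ≤ L) :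
    (((Finset.univ.filter fun x : Site 2 L => ¬inR l (x 0).val (x 1).val).card : ℕ) : ℝ) =
      ((L ^ 2 - ((l + 1) * (l + 1) - 4) : ℕ) : ℝ) := by
  classical
  have h := Finset.card_filter_add_card_filter_not
    (s := (Finset.univ : Finset (Site 2 L))) (fun x : Site 2 L => inR l (x 0).val (x 1).val)
  rw [Finset.card_univ, card_site_two] at h
  have h' : (((Finset.univ.filter fun x : Site 2 L => ¬inR l (x 0).val (x 1).val).card : ℕ) : ℝ) =
      (L : ℝ) ^ 2 - (((l + 1) * (l + 1) - 4 : ℕ) : ℝ) := by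
    rw [← card_filter_inR hl hlL]
    have := congrArg (fun n : ℕ => (n : ℝ)) h
    push_cast at this ⊢
    linarith
  rw [h', natCast_boxM hl hlL, natCast_boxN hl]

/-- `5 ≤ N`. [folklore] -/
theorem five_le_boxN_real (hl : 2 ≤ l) : (5 : ℝ) ≤ (((l + 1) * (l + 1) - 4 : ℕ) : ℝ) := by
  rw [natCast_boxN hl]
  have h2 : (2 : ℝ) ≤ l := by exact_mod_cast hl
  nlinarith

/-- `α_l = 2π/N`. [folklore] -/
theorem boxAlpha_eq_div (hl : 2 ≤ l) :
    boxAlpha l = 2 * π / (((l + 1) * (l + 1) - 4 : ℕ) : ℝ) := by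
  rw [natCast_boxN hl]; rfl

/-- The plaquettes of the block spread in the generic form `e^{iα·1_R}`. [folklore] -/
theorem plaquetteHolonomy_boxSpread_ite (hl : 2 ≤ l) (hlL : l + 1 ≤ L) (x : Site 2 L) :
    plaquetteHolonomy (boxSpread l) x 0 1 =
      Circle.exp (if x ∈ (Finset.univ.filter fun x : Site 2 L => inR l (x 0).val (x 1).val)
        then boxAlpha l else 0) := by
  rw [plaquetteHolonomy_boxSpread hl hlL]
  simp only [Finset.mem_filter, Finset.mem_univ, true_and, boxF]

/-- **THE MOUNTAIN-PASS INEQUALITY FOR THE BLOCK** (`2 ≤ l`, `l + 1 ≤ L`, `2N ≤ L²`): for EVERY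
configuration `U` whose charge is changed by the block insertion, `max(S(U), S(WU)) ≥
N(1 − cos(α_l/2)) + M(1 − cos(π/M))`. [folklore] -/
theorem sharpValue_le_max_wilsonAction (hl : 2 ≤ l) (hlL : l + 1 ≤ L)
    (hNM : 2 * ((l + 1) * (l + 1) - 4) ≤ L ^ 2) (U : GaugeConfig 2 L Circle)
    (hne : topCharge (0 : Site 2 L) 0 1 (boxSpread l * U) ≠ topCharge (0 : Site 2 L) 0 1 U) :
    (((l + 1) * (l + 1) - 4 : ℕ) : ℝ) * (1 - Real.cos (boxAlpha l / 2)) +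
        ((L ^ 2 - ((l + 1) * (l + 1) - 4) : ℕ) : ℝ) *
          (1 - Real.cos (π / ((L ^ 2 - ((l + 1) * (l + 1) - 4) : ℕ) : ℝ))) ≤
      max (wilsonAction u1Rep U) (wilsonAction u1Rep (boxSpread l * U)) := by
  classical
  set R := Finset.univ.filter fun x : Site 2 L => inR l (x 0).val (x 1).val with hR
  have hRn : (R.card : ℝ) = (((l + 1) * (l + 1) - 4 : ℕ) : ℝ) := card_filter_inR hl hlL
  have hRc : Rᶜ = Finset.univ.filter fun x : Site 2 L => ¬inR l (x 0).val (x 1).val := by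
    ext x; simp [hR]
  have hRcm : (Rᶜ.card : ℝ) = ((L ^ 2 - ((l + 1) * (l + 1) - 4) : ℕ) : ℝ) := by
    rw [hRc]; exact card_filter_not_inR hl hlL
  have hN5 : 5 ≤ R.card := by
    have := five_le_boxN_real hl
    rw [← hRn] at this
    exact_mod_cast this
  have hNM' : R.card ≤ Rᶜ.card := by
    have h2 : 2 * (((l + 1) * (l + 1) - 4 : ℕ) : ℝ) ≤ (L : ℝ) ^ 2 := by exact_mod_cast hNM
    have hM : ((L ^ 2 - ((l + 1) * (l + 1) - 4) : ℕ) : ℝ) =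
        (L : ℝ) ^ 2 - (((l + 1) * (l + 1) - 4 : ℕ) : ℝ) := by
      rw [natCast_boxM hl hlL, natCast_boxN hl]
    have : (R.card : ℝ) ≤ (Rᶜ.card : ℝ) := by rw [hRn, hRcm, hM]; linarith
    exact_mod_cast this
  have hNα : (R.card : ℝ) * boxAlpha l = 2 * π := by
    rw [hRn, natCast_boxN hl]
    obtain ⟨h1, h3⟩ := boxDen_ne_zero hl
    unfold boxAlpha
    field_simp
  have h := sharpValue_le_max_wilsonAction_of_exp (boxSpread l) U R
    (plaquetteHolonomy_boxSpread_ite hl hlL) (boxAlpha_pos hl) hNα hN5 hNM' hne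
  rwa [hRn, hRcm] at h

/-- **The sector floor bounds the max** (every regime, `3 ≤ L`): if `Q(XU) ≠ Q(U)` then
`max(S(U), S(XU)) ≥ L²(1 − cos(2π/L²))`, since one of the two charges is nonzero. [folklore] -/
theorem sectorFloor_le_max_wilsonAction (hL : 3 ≤ L) (X U : GaugeConfig 2 L Circle)
    (hne : topCharge (0 : Site 2 L) 0 1 (X * U) ≠ topCharge (0 : Site 2 L) 0 1 U) :
    (L : ℝ) ^ 2 * (1 - Real.cos (2 * π / (L : ℝ) ^ 2)) ≤
      max (wilsonAction u1Rep U) (wilsonAction u1Rep (X * U)) := by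
  by_cases hU : topCharge (0 : Site 2 L) 0 1 U = 0
  · rw [hU] at hne
    exact le_max_of_le_right (wilsonAction_ge_of_topCharge_ne_zero hL _ hne)
  · exact le_max_of_le_left (wilsonAction_ge_of_topCharge_ne_zero hL _ hU)

end Block

/-! ## §2 The witness beyond half the torus: the evenly spread instanton -/

section Witness

variable {L : ℕ} [NeZero L] {l : ℕ}

omit [NeZero L] in
/-- The witness table `2π/L² − boxF` (the plaquette angles of `W⁻¹ · (uniform charge-one field)`)
has total zero. [folklore] -/
theorem sum_instTable (hl : 2 ≤ l) (hlL : l + 1 ≤ L) :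
    ∑ a ∈ Finset.range L, ∑ b ∈ Finset.range L, (2 * π / (L : ℝ) ^ 2 - boxF l a b) = 0 := by
  have hL : (0 : ℝ) < (L : ℝ) ^ 2 := by
    have : (1 : ℝ) ≤ L := by exact_mod_cast (show 1 ≤ L by omega)
    positivity
  have h := sum_boxF_affine (l := l) (L := L) hl hlL (-1) (2 * π / (L : ℝ) ^ 2)
  have e : ∀ a b, boxF l a b * (-1) + 2 * π / (L : ℝ) ^ 2 = 2 * π / (L : ℝ) ^ 2 - boxF l a b := by
    intro a b; ring
  simp only [e] at h
  have hL1 : (L : ℝ) ≠ 0 := by exact_mod_cast (show L ≠ 0 by omega)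
  have e2 : (L : ℝ) ^ 2 * (2 * π / (L : ℝ) ^ 2) = 2 * π := by field_simp
  rw [h, e2]
  ring

omit [NeZero L] in
/-- Bounds on the witness table and on its insertion: both stay strictly inside `(−π, π)`.
[folklore] -/
theorem instTable_bounds (hl : 2 ≤ l) (hlL : l + 1 ≤ L) (a b : ℕ) :
    -π < 2 * π / (L : ℝ) ^ 2 - boxF l a b ∧ 2 * π / (L : ℝ) ^ 2 - boxF l a b < π ∧
      0 < boxF l a b + (2 * π / (L : ℝ) ^ 2 - boxF l a b) ∧
        boxF l a b + (2 * π / (L : ℝ) ^ 2 - boxF l a b) < π := by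
  have hL3 : (3 : ℝ) ≤ L := by exact_mod_cast (show 3 ≤ L by omega)
  have h9 : (9 : ℝ) ≤ (L : ℝ) ^ 2 := by nlinarith
  have hθ : 0 < 2 * π / (L : ℝ) ^ 2 := by positivity
  have hθ' : 2 * π / (L : ℝ) ^ 2 ≤ 2 * π / 9 :=
    div_le_div_of_nonneg_left (by positivity) (by norm_num) h9
  have h0 := boxF_nonneg hl a b
  have h1 := (boxF_le hl a b).trans (boxAlpha_lt_pi hl).le
  refine ⟨by linarith [Real.pi_pos], by linarith [Real.pi_pos], by linarith, by linarith [Real.pi_pos]⟩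

omit [NeZero L] in
/-- Beyond half the torus `α_l ≤ 4π/L²`, so `cos(2π/L²) ≤ cos(2π/L² − boxF)`. [folklore] -/
theorem cos_le_cos_instTable (hl : 2 ≤ l) (hlL : l + 1 ≤ L)
    (hMN : L ^ 2 ≤ 2 * ((l + 1) * (l + 1) - 4)) (a b : ℕ) :
    Real.cos (2 * π / (L : ℝ) ^ 2) ≤ Real.cos (2 * π / (L : ℝ) ^ 2 - boxF l a b) := by
  have hL3 : (3 : ℝ) ≤ L := by exact_mod_cast (show 3 ≤ L by omega)
  have h9 : (9 : ℝ) ≤ (L : ℝ) ^ 2 := by nlinarith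
  have hpos : (0 : ℝ) < (((l + 1) * (l + 1) - 4 : ℕ) : ℝ) := by linarith [five_le_boxN_real hl]
  have hαL : boxAlpha l ≤ 2 * (2 * π / (L : ℝ) ^ 2) := by
    rw [boxAlpha_eq_div hl, div_le_iff₀ hpos]
    have h2 : ((L ^ 2 : ℕ) : ℝ) ≤ ((2 * ((l + 1) * (l + 1) - 4) : ℕ) : ℝ) := by exact_mod_cast hMN
    push_cast at h2
    have e : 2 * (2 * π / (L : ℝ) ^ 2) * (((l + 1) * (l + 1) - 4 : ℕ) : ℝ) =
        2 * π * (2 * (((l + 1) * (l + 1) - 4 : ℕ) : ℝ) / (L : ℝ) ^ 2) := by ring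
    rw [e]
    have : (1 : ℝ) ≤ 2 * (((l + 1) * (l + 1) - 4 : ℕ) : ℝ) / (L : ℝ) ^ 2 := by
      rw [le_div_iff₀ (by positivity)]; linarith
    nlinarith [Real.pi_pos]
  have h0 := boxF_nonneg hl a b
  have h1 := boxF_le hl a b
  have hθπ : 2 * π / (L : ℝ) ^ 2 ≤ π := by
    rw [div_le_iff₀ (by positivity)]; nlinarith [Real.pi_pos]
  have habs : |2 * π / (L : ℝ) ^ 2 - boxF l a b| ≤ 2 * π / (L : ℝ) ^ 2 := by
    rw [abs_le]; constructor <;> linarith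
  have := Real.cos_le_cos_of_nonneg_of_le_pi (abs_nonneg _) hθπ habs
  rwa [Real.cos_abs] at this

/-- **Beyond half the torus the evenly spread instanton is a lower pass**: for `L² ≤ 2N`
(`2 ≤ l`, `l + 1 ≤ L`), `boxHeight l L ≤ L²(1 − cos(2π/L²))`, witnessed by
`U₀ = potField(2π/L² − boxF)` (`Q(U₀) = 0`, `Q(WU₀) = 1`, `S(U₀) ≤ S(WU₀) = L²(1 − cos(2π/L²))`).
[folklore] -/
theorem boxHeight_le_sectorFloor_ennreal (hl : 2 ≤ l) (hlL : l + 1 ≤ L)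
    (hMN : L ^ 2 ≤ 2 * ((l + 1) * (l + 1) - 4)) :
    boxHeight l L ≤ ENNReal.ofReal ((L : ℝ) ^ 2 * (1 - Real.cos (2 * π / (L : ℝ) ^ 2))) := by
  have hL1 : 1 < L := by omega
  set c : ℕ → ℕ → ℝ := fun a b => 2 * π / (L : ℝ) ^ 2 - boxF l a b with hc_def
  have hcs : ∑ a ∈ Finset.range L, ∑ b ∈ Finset.range L, c a b = 0 := by
    simp only [hc_def]; exact sum_instTable hl hlL
  set U₀ : GaugeConfig 2 L Circle := potField c with hU₀
  have hP : ∀ x : Site 2 L, plaquetteHolonomy U₀ x 0 1 = Circle.exp (c (x 0).val (x 1).val) :=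
    plaquetteHolonomy_potField hL1 hcs
  have hPX : ∀ x : Site 2 L, plaquetteHolonomy (boxSpread l * U₀) x 0 1 =
      Circle.exp (boxF l (x 0).val (x 1).val + c (x 0).val (x 1).val) := by
    intro x
    rw [plaquetteHolonomy_mul', plaquetteHolonomy_boxSpread hl hlL, hP, Circle.exp_add]
  have hb : ∀ a b, -π < c a b ∧ c a b < π ∧ 0 < boxF l a b + c a b ∧ boxF l a b + c a b < π :=
    fun a b => instTable_bounds hl hlL a b
  have hFU : ∀ x : Site 2 L, abelianFieldTensor U₀ x 0 1 = c (x 0).val (x 1).val := by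
    intro x
    obtain ⟨h1, h2, -, -⟩ := hb (x 0).val (x 1).val
    exact abelianFieldTensor_eq_of_plaquette_eq_exp (hP x) h1 h2.le
  have hFX : ∀ x : Site 2 L, abelianFieldTensor (boxSpread l * U₀) x 0 1 =
      boxF l (x 0).val (x 1).val + c (x 0).val (x 1).val := by
    intro x
    obtain ⟨-, -, h3, h4⟩ := hb (x 0).val (x 1).val
    exact abelianFieldTensor_eq_of_plaquette_eq_exp (hPX x) (by linarith [Real.pi_pos]) h4.le
  have hQU : topCharge (0 : Site 2 L) 0 1 U₀ = 0 := by
    rw [topCharge_of_fieldTensor hFU, hcs, zero_div]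
  have hQX : topCharge (0 : Site 2 L) 0 1 (boxSpread l * U₀) = 1 := by
    rw [topCharge_of_fieldTensor (g := fun a b => boxF l a b + c a b) hFX]
    simp only [Finset.sum_add_distrib]
    rw [sum_boxF hl hlL, hcs, add_zero]
    field_simp
  have e2 : ∀ a b, boxF l a b + c a b = 2 * π / (L : ℝ) ^ 2 := by
    intro a b; simp only [hc_def]; ring
  have hSX : wilsonAction u1Rep (boxSpread l * U₀) =
      (L : ℝ) ^ 2 * (1 - Real.cos (2 * π / (L : ℝ) ^ 2)) := by
    rw [wilsonAction_of_plaquette_exp (g := fun a b => boxF l a b + c a b) hPX]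
    simp only [e2, Finset.sum_const, Finset.card_range, nsmul_eq_mul]
    ring
  have hSU : wilsonAction u1Rep U₀ ≤ wilsonAction u1Rep (boxSpread l * U₀) := by
    rw [wilsonAction_of_plaquette_exp hP,
      wilsonAction_of_plaquette_exp (g := fun a b => boxF l a b + c a b) hPX]
    refine Finset.sum_le_sum fun a _ => Finset.sum_le_sum fun b _ => ?_
    rw [e2]
    have := cos_le_cos_instTable hl hlL hMN a b
    simp only [hc_def]
    linarith
  have h1 := insHeight_le_of_witness (boxSpread (L := L) l) U₀ (0 : Site 2 L) 0 1
    (fun x => by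
      obtain ⟨h₁, h₂, -, -⟩ := hb (x 0).val (x 1).val
      rw [hP]
      exact coe_circleExp_mem_slitPlane h₁ h₂)
    (fun x => by
      obtain ⟨-, -, h₃, h₄⟩ := hb (x 0).val (x 1).val
      rw [hPX]
      exact coe_circleExp_mem_slitPlane (by linarith [Real.pi_pos]) h₄)
    (by rw [hQX, hQU]; exact one_ne_zero)
  rw [max_eq_right hSU, hSX] at h1
  exact (min_le_left _ _).trans h1

end Witness

end Summit.Ventures.LatticeQCDFlow.Theory2.Lattice.Flux

end
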